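import Literature.Topology.FourManifolds.TrisectionsHandlebodyH23
import Literature.Topology.FourManifolds.BoundarySliceCharts
import HarnessLib

/-!
# The third handlebody `H₂₃ = X₂ ∩ X₃` of the trisection from a handle decomposition: its
# manifold-with-boundary structure and clause (iii) for the pair `(X₂, X₃)` (Gay–Kirby 2016, Lemma 14)

Topic `Literature/Topology/FourManifolds`; for the fact seat
`provefact-Literature.Topology.FourManifolds.exists_isBalancedGKTrisection` (Gay–Kirby 2016,
Thm. 4 via Lemma 14).  Everything in this file is **proved**; no named facts are introduced.

`TrisectionsHandlebodyH23.lean` decomposes `H₂₃ = X₂ ∩ X₃` into the central surface `F`, the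
rounded interface `{x ∉ X₁, x hits ∂X₁⁰, M x = 0}` and the sheet tops `{x ∉ X₁, x does not hit,
f x = c}`, and shows that near `F` it is the half-sheet `{r = 0, s ≥ 0}` of the bi-collar box.
Here `H₂₃` is made a compact `3`-dimensional submanifold **with boundary `F`** of the closed
`4`-manifold `X`, using the boundary slice charts of `BoundarySliceCharts.lean` (Lee 2013,
Thm. 5.51):

* at a point of the rounded interface, the straightening function of `M`
  (`TriData.strFun`, `TrisectionsMiddleCharts.lean`) is regular and cuts out `H₂₃` on the
  straightening domain — an interior slice chart (`hitSlice`);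
* at a sheet top, `f` is regular (`c` is a regular value) and cuts out `H₂₃ = {f = c}` on the
  neighbourhood of `TriData.exists_nhds_top` — an interior slice chart (`topSlice`);
* at a point of the bi-collar box (in particular along `F`), the wedge chart `(s, r, χ ∘ zL)` of
  the bi-collar with its coordinates reordered to `(s, χ₁, χ₀, r)` is a boundary slice chart:
  `H₂₃ = {r = 0, s ≥ 0}` (`boxSlice`);
* `TriData.bsliceAtlas` — the atlas; `isBoundaryPoint_iff_mem_surface`: the boundary points of
  `H₂₃` are exactly the points of `F`; `image_boundary_H₂₃`;
* **`TriData.exists_H₂₃`** — clause (iii) of `IsGKTrisection` for the pair `(X₂, X₃)`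
  (`TriData.ClauseIII gen 1 2` of `TrisectionsAssembly.lean`) *modulo* the connectedness and the
  handle decomposition `HasHandleDecomposition 2 ↥H₂₃ (handleCount 1 gen)` of this structure —
  Gay–Kirby's "`H₂₃ = F × [-ε, ε] ∪ 2`-handles, which is a handlebody" (proof of Lemma 14), the
  remaining Morse-theoretic input; and `isGKTrisection_of'`, the assembly theorem of
  `TrisectionsAssembly.lean` with the hypothesis on `H₂₃` in this reduced form.

## References

* D. Gay, R. Kirby, *Trisecting 4-manifolds*, Geom. Topol. 20 (2016) 3097–3132
  (arXiv:1205.1565): Def. 1; §4, Lemma 14 and its proof. [GayKirby2016]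
* J. M. Lee, *Introduction to Smooth Manifolds*, 2nd ed. (2013), Thm. 5.51. [LeeSmoothManifolds2013]
-/

open scoped Manifold ContDiff Topology
open Set Function Filter

noncomputable section

universe u

namespace Literature.Topology.FourManifolds

/-- Local notation: `𝔼 n` is the model Euclidean space `EuclideanSpace ℝ (Fin n)`. -/
local notation "𝔼 " n:arg => EuclideanSpace ℝ (Fin n)

variable {X : Type u} [TopologicalSpace X] [T2Space X] [CompactSpace X]
  [ChartedSpace (EuclideanSpace ℝ (Fin 4)) X] [IsManifold (𝓡 4) ∞ X]

namespace BiCollar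

namespace TriData

variable {B : BiCollar X} (T : B.TriData)

/-! ### (A) Interior slice charts at points of the rounded interface -/

/-- On the straightening domain of a point of the rounded interface, `H₂₃` is the zero set of
the straightening function. [cite: GayKirby2016, §4, Lemma 14] -/
theorem mem_H₂₃_iff_of_mem_strDom {p : X} (hp : B.Hit p) (h0 : T.M p = 0) {q : X}
    (hq : q ∈ T.strDom hp h0) : q ∈ T.H₂₃ ↔ T.strFun hp h0 q = T.strFun hp h0 p := by
  have hF : T.strFun hp h0 q = T.M q := interior_subset (s := {y | T.strFun hp h0 y = T.M y}) hq.2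
  have hFp : T.strFun hp h0 p = T.M p := (T.strFun_eventuallyEq hp h0).eq_of_nhds
  rw [hF, hFp, h0, H₂₃, mem_inter_iff, T.mem_X₂_iff_of_hit hq.1.1 hq.1.2, T.mem_X₃_iff_of_hit hq.1.1 hq.1.2]
  exact ⟨fun h => le_antisymm h.1 h.2, fun h => ⟨h.le, h.ge⟩⟩

/-- The existence statement behind `hitSlice`. [cite: LeeSmoothManifolds2013, Thm. 5.51] -/
theorem exists_hitSlice {p : X} (hp : B.Hit p) (h0 : T.M p = 0) (hp₁ : p ∉ T.X₁) :
    ∃ D : BoundarySliceChart 2 T.H₂₃, p ∈ D.Θ.source ∧ D.Θ.source ⊆ T.strDom hp h0 ∧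
      ∀ q ∈ D.Θ.source, 0 < D.Θ q 0 :=
  exists_boundarySliceChart_of_not_isMCriticalPt (T.contMDiff_strFun hp h0) (T.not_isMCriticalPt_strFun hp h0)
    (T.isOpen_strDom hp h0) (T.mem_strDom hp h0 hp₁) fun _ hq => T.mem_H₂₃_iff_of_mem_strDom hp h0 hq

/-- **The interior slice chart of `H₂₃` at a point of the rounded interface.**
[cite: GayKirby2016, §4, Lemma 14; LeeSmoothManifolds2013, Thm. 5.51] -/
def hitSlice {p : X} (hp : B.Hit p) (h0 : T.M p = 0) (hp₁ : p ∉ T.X₁) : BoundarySliceChart 2 T.H₂₃ :=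
  Classical.choose (T.exists_hitSlice hp h0 hp₁)

/-- The point lies in the source of its chart. [folklore] -/
theorem mem_hitSlice_source {p : X} (hp : B.Hit p) (h0 : T.M p = 0) (hp₁ : p ∉ T.X₁) :
    p ∈ (T.hitSlice hp h0 hp₁).Θ.source :=
  (Classical.choose_spec (T.exists_hitSlice hp h0 hp₁)).1

/-- The `0`-th coordinate of the chart is positive on its source. [folklore] -/
theorem hitSlice_apply_zero_pos {p : X} (hp : B.Hit p) (h0 : T.M p = 0) (hp₁ : p ∉ T.X₁) {q : X}
    (hq : q ∈ (T.hitSlice hp h0 hp₁).Θ.source) : 0 < (T.hitSlice hp h0 hp₁).Θ q 0 :=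
  (Classical.choose_spec (T.exists_hitSlice hp h0 hp₁)).2.2 q hq

/-! ### (B) Interior slice charts at the sheet tops -/

section Top

variable {η : ℝ} (hη : 2 * T.ε ≤ η)
  (hL : ∀ q : X, IsMCriticalPt (𝓡 4) B.f q → B.a < B.f q → B.f q ≤ T.c →
    ∀ y : B.Y, RegularLevel.incl B.hf y ∈ stableSet (𝓡 4) B.U.ξ q → B.g y < B.b - η)

include hη hL in
/-- The existence statement behind `topSlice`: near a sheet top, `H₂₃ = {f = c}` and `f` is
regular. [cite: GayKirby2016, §4, Lemma 14; LeeSmoothManifolds2013, Thm. 5.51] -/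
theorem exists_topSlice {p : X} (hp : p ∈ T.sheets) (hp₁ : p ∉ T.X₁) (hpc : B.f p = T.c) :
    ∃ D : BoundarySliceChart 2 T.H₂₃, p ∈ D.Θ.source ∧ (∀ q ∈ D.Θ.source, q ∉ B.surface) ∧
      ∀ q ∈ D.Θ.source, 0 < D.Θ q 0 := by
  obtain ⟨N, hNo, hpN, hNs, hN2, hN3⟩ := T.exists_nhds_top hη hL hp hp₁ hpc
  have hS : ∀ q ∈ N, q ∈ T.H₂₃ ↔ B.f q = B.f p := fun q hq => by
    rw [H₂₃, mem_inter_iff, hN2 q hq, hN3 q hq, hpc]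
    exact ⟨fun h => le_antisymm h.1 h.2, fun h => ⟨h.le, h.ge⟩⟩
  obtain ⟨D, hpD, hDN, hD0⟩ := exists_boundarySliceChart_of_not_isMCriticalPt B.U.contMDiff_f
    (T.regular_c p hpc) hNo hpN hS
  exact ⟨D, hpD, fun q hq => hNs q (hDN hq), hD0⟩

/-- **The interior slice chart of `H₂₃` at a sheet top.** [cite: GayKirby2016, §4, Lemma 14; LeeSmoothManifolds2013, Thm. 5.51] -/
def topSlice {p : X} (hp : p ∈ T.sheets) (hp₁ : p ∉ T.X₁) (hpc : B.f p = T.c) : BoundarySliceChart 2 T.H₂₃ :=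
  Classical.choose (T.exists_topSlice hη hL hp hp₁ hpc)

/-- The point lies in the source of its chart. [folklore] -/
theorem mem_topSlice_source {p : X} (hp : p ∈ T.sheets) (hp₁ : p ∉ T.X₁) (hpc : B.f p = T.c) :
    p ∈ (T.topSlice hη hL hp hp₁ hpc).Θ.source :=
  (Classical.choose_spec (T.exists_topSlice hη hL hp hp₁ hpc)).1

/-- The `0`-th coordinate of the chart is positive on its source. [folklore] -/
theorem topSlice_apply_zero_pos {p : X} (hp : p ∈ T.sheets) (hp₁ : p ∉ T.X₁) (hpc : B.f p = T.c) {q : X}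
    (hq : q ∈ (T.topSlice hη hL hp hp₁ hpc).Θ.source) : 0 < (T.topSlice hη hL hp hp₁ hpc).Θ q 0 :=
  (Classical.choose_spec (T.exists_topSlice hη hL hp hp₁ hpc)).2.2 q hq

end Top

/-! ### (C) Boundary slice charts on the bi-collar box -/

/-- The wedge frame `u = s`, `v = r`. [folklore] -/
def frame₀ : WedgeFrame := ⟨1, 0, 0, 1, by norm_num⟩

/-- `u = s` for the frame `frame₀`. [folklore] -/
@[simp] theorem uFun_frame₀ (x : X) : B.uFun frame₀ x = B.sFun x := by
  simp [BiCollar.uFun, WedgeFrame.u, frame₀]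

/-- `v = r` for the frame `frame₀`. [folklore] -/
@[simp] theorem vFun_frame₀ (x : X) : B.vFun frame₀ x = B.rFun x := by
  simp [BiCollar.vFun, WedgeFrame.v, frame₀]

/-- The reordering `(y₀, y₁, y₂, y₃) ↦ (y₀, y₃, y₂, y₁)` of the coordinates of `ℝ⁴` (so that the
last coordinate of the reordered wedge chart is `r` and the `0`-th one is `s`). [folklore] -/
def swap13 : (𝔼 4) ≃L[ℝ] 𝔼 4 := permCoords (Equiv.swap (1 : Fin 4) 3)

/-- Coordinate `3` after reordering is coordinate `1`. [folklore] -/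
@[simp] theorem swap13_apply_three (y : 𝔼 4) : swap13 y 3 = y 1 := by
  rw [swap13, permCoords_apply, Equiv.symm_swap, Equiv.swap_apply_right]

/-- Coordinate `0` is kept. [folklore] -/
@[simp] theorem swap13_apply_zero (y : 𝔼 4) : swap13 y 0 = y 0 := by
  rw [swap13, permCoords_apply, Equiv.symm_swap, Equiv.swap_apply_of_ne_of_ne (by decide) (by decide)]

/-- **The boundary slice chart of `H₂₃` on the bi-collar box**: the wedge chart
`(s, r, χ ∘ zL)` of radius `ε_w` with the chart `χ` of `F` at `zL p`, reordered to
`(s, χ₁, χ₀, r)`; on its source `H₂₃ = {r = 0, s ≥ 0}`. [cite: GayKirby2016, Def. 1 and §4, Lemma 14; LeeSmoothManifolds2013, Thm. 5.51] -/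
def boxSlice (p : X) : BoundarySliceChart 2 T.H₂₃ :=
  BoundarySliceChart.ofEquiv
    (B.wedgeChart frame₀ (chartAt (𝔼 2) (B.zL p)) T.D.εw (IsManifold.chart_mem_maximalAtlas (B.zL p))
      T.D.εw_le_δU T.D.εw_le_δV)
    (contMDiffOn_wedgeFun B frame₀ _ T.D.εw (IsManifold.chart_mem_maximalAtlas (B.zL p)) T.D.εw_le_δU T.D.εw_le_δV)
    (contMDiffOn_wedgeInv B frame₀ _ T.D.εw (IsManifold.chart_mem_maximalAtlas (B.zL p)))
    swap13
    (fun q hq => by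
      have hq' : q ∈ B.box T.D.εw := hq.1
      rw [T.mem_H₂₃_iff_of_mem_box hq']
      show _ ↔ swap13 (B.wedgeFun frame₀ (chartAt (𝔼 2) (B.zL p)) q) (3 : Fin 4) = 0 ∧
        0 ≤ swap13 (B.wedgeFun frame₀ (chartAt (𝔼 2) (B.zL p)) q) 0
      rw [swap13_apply_three, swap13_apply_zero, wedgeFun_apply_one, wedgeFun_apply_zero, uFun_frame₀, vFun_frame₀])

/-- The source of the box chart is the wedge source: the box of radius `ε_w` cut down to
`zL⁻¹` of the chart domain of `χ`. [folklore] -/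
theorem boxSlice_source (p : X) :
    (T.boxSlice p).Θ.source = B.wedgeSource (chartAt (𝔼 2) (B.zL p)) T.D.εw :=
  BoundarySliceChart.ofEquiv_source _ _ _ _ _

/-- A point of the box lies in the source of its box chart. [folklore] -/
theorem mem_boxSlice_source {p : X} (hp : p ∈ B.box T.D.εw) : p ∈ (T.boxSlice p).Θ.source := by
  rw [boxSlice_source]
  exact ⟨hp, show B.zL p ∈ (chartAt (𝔼 2) (B.zL p)).source from mem_chart_source _ _⟩

/-- The source of the box chart lies in the box. [folklore] -/
theorem boxSlice_source_subset (p : X) : (T.boxSlice p).Θ.source ⊆ B.box T.D.εw := by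
  rw [boxSlice_source]; exact fun _ hq => hq.1

/-- The `0`-th coordinate of the box chart is `s`. [folklore] -/
theorem boxSlice_apply_zero (p q : X) : (T.boxSlice p).Θ q 0 = B.sFun q := by
  rw [boxSlice, BoundarySliceChart.ofEquiv_apply, wedgeChart_apply, swap13_apply_zero, wedgeFun_apply_zero,
    uFun_frame₀]

/-! ### The atlas -/

section Atlas

variable (hc2 : B.a + B.U.δ + 2 * T.ε ≤ T.c) {η : ℝ} (hη : 2 * T.ε ≤ η)
  (hL : ∀ q : X, IsMCriticalPt (𝓡 4) B.f q → B.a < B.f q → B.f q ≤ T.c →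
    ∀ y : B.Y, RegularLevel.incl B.hf y ∈ stableSet (𝓡 4) B.U.ξ q → B.g y < B.b - η)

include hc2 in
/-- A point of `H₂₃` outside the box lies outside `X₁` (`H₂₃ ∩ X₁ = F` lies in the box). [folklore] -/
theorem not_mem_X₁_of_mem_H₂₃_of_not_mem_box {p : X} (hp : p ∈ T.H₂₃) (hpb : p ∉ B.box T.D.εw) :
    p ∉ T.X₁ := fun h1 => by
  have hs : p ∈ B.surface := by rw [← T.H₂₃_inter_X₁ hc2]; exact ⟨hp, h1⟩
  exact hpb (B.mem_box_of_mem_surface T.D.εw_pos hs)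

open Classical in
/-- **The boundary slice atlas of `H₂₃`**: box charts on the box, straightening charts of `M` at
the points of the rounded interface, straightening charts of `f` at the sheet tops.
[cite: GayKirby2016, §4, Lemma 14; LeeSmoothManifolds2013, Thm. 5.51] -/
def bsliceAtlas : BoundarySliceAtlas 2 T.H₂₃ where
  datum p :=
    if hb : p.1 ∈ B.box T.D.εw then T.boxSlice p.1
    else if hh : B.Hit p.1 then
      T.hitSlice hh (T.M_eq_zero_of_mem_H₂₃ p.2 hh) (T.not_mem_X₁_of_mem_H₂₃_of_not_mem_box hc2 p.2 hb)
    else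
      T.topSlice hη hL
        (T.mem_sheets_of_mem_X₂ p.2.1 (T.not_mem_X₁_of_mem_H₂₃_of_not_mem_box hc2 p.2 hb) hh)
        (T.not_mem_X₁_of_mem_H₂₃_of_not_mem_box hc2 p.2 hb)
        (T.f_eq_c_of_mem_H₂₃ hη hL p.2 (T.not_mem_X₁_of_mem_H₂₃_of_not_mem_box hc2 p.2 hb) hh)
  mem_source p := by
    by_cases hb : p.1 ∈ B.box T.D.εw
    · simp only [hb, ↓reduceDIte]
      exact T.mem_boxSlice_source hb
    · by_cases hh : B.Hit p.1
      · simp only [hb, hh, ↓reduceDIte]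
        exact T.mem_hitSlice_source hh _ _
      · simp only [hb, hh, ↓reduceDIte]
        exact T.mem_topSlice_source hη hL _ _ _

/-- On the box, the chart of the atlas is the box chart. [folklore] -/
theorem bsliceAtlas_datum_of_mem_box (p : T.H₂₃) (hb : p.1 ∈ B.box T.D.εw) :
    (T.bsliceAtlas hc2 hη hL).datum p = T.boxSlice p.1 := by
  classical
  exact dif_pos hb

/-- Off the box, the `0`-th coordinate of the chart of the atlas is positive at the point. [folklore] -/
theorem bsliceAtlas_datum_apply_zero_pos (p : T.H₂₃) (hb : p.1 ∉ B.box T.D.εw) :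
    0 < ((T.bsliceAtlas hc2 hη hL).datum p).Θ p.1 0 := by
  classical
  by_cases hh : B.Hit p.1
  · have h : (T.bsliceAtlas hc2 hη hL).datum p = T.hitSlice hh (T.M_eq_zero_of_mem_H₂₃ p.2 hh)
        (T.not_mem_X₁_of_mem_H₂₃_of_not_mem_box hc2 p.2 hb) := by
      show (if hb : p.1 ∈ B.box T.D.εw then _ else _) = _
      rw [dif_neg hb, dif_pos hh]
    rw [h]
    exact T.hitSlice_apply_zero_pos hh _ _ (T.mem_hitSlice_source hh _ _)
  · have h : (T.bsliceAtlas hc2 hη hL).datum p = T.topSlice hη hL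
        (T.mem_sheets_of_mem_X₂ p.2.1 (T.not_mem_X₁_of_mem_H₂₃_of_not_mem_box hc2 p.2 hb) hh)
        (T.not_mem_X₁_of_mem_H₂₃_of_not_mem_box hc2 p.2 hb)
        (T.f_eq_c_of_mem_H₂₃ hη hL p.2 (T.not_mem_X₁_of_mem_H₂₃_of_not_mem_box hc2 p.2 hb) hh) := by
      show (if hb : p.1 ∈ B.box T.D.εw then _ else _) = _
      rw [dif_neg hb, dif_neg hh]
    rw [h]
    exact T.topSlice_apply_zero_pos hη hL _ _ _ (T.mem_topSlice_source hη hL _ _ _)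

/-- **The boundary points of `H₂₃` are the points of the central surface.**
[cite: GayKirby2016, Def. 1 and §4, Lemma 14] -/
theorem isBoundaryPoint_iff_mem_surface (p : T.H₂₃) :
    letI := (T.bsliceAtlas hc2 hη hL).chartedSpace
    (𝓡∂ 3).IsBoundaryPoint p ↔ p.1 ∈ B.surface := by
  rw [(T.bsliceAtlas hc2 hη hL).isBoundaryPoint_iff p]
  by_cases hb : p.1 ∈ B.box T.D.εw
  · rw [T.bsliceAtlas_datum_of_mem_box hc2 hη hL p hb, T.boxSlice_apply_zero,
      T.mem_surface_iff_of_mem_H₂₃_of_mem_box hb p.2]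
  · have hpos := T.bsliceAtlas_datum_apply_zero_pos hc2 hη hL p hb
    exact ⟨fun h => absurd h hpos.ne', fun hs => absurd (B.mem_box_of_mem_surface T.D.εw_pos hs) hb⟩

/-- **The boundary of `H₂₃` is the central surface `F`.** [cite: GayKirby2016, Def. 1 and §4, Lemma 14] -/
theorem image_boundary_H₂₃ :
    letI := (T.bsliceAtlas hc2 hη hL).chartedSpace
    Subtype.val '' (𝓡∂ 3).boundary T.H₂₃ = B.surface := by
  letI := (T.bsliceAtlas hc2 hη hL).chartedSpace
  ext x
  constructor
  · rintro ⟨p, hp, rfl⟩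
    exact (T.isBoundaryPoint_iff_mem_surface hc2 hη hL p).1 hp
  · intro hx
    exact ⟨⟨x, T.surface_subset_H₂₃ hx⟩, (T.isBoundaryPoint_iff_mem_surface hc2 hη hL _).2 hx, rfl⟩

/-- `H₂₃` is compact. [folklore] -/
theorem compactSpace_H₂₃ : CompactSpace T.H₂₃ := isCompact_iff_compactSpace.1 T.isCompact_H₂₃

/-- **Clause (iii) for the pair `(X₂, X₃)`**, modulo the connectedness and the handle
decomposition of `H₂₃` (with the structure `bsliceAtlas`): `H₂₃` is a compact `3`-manifold with
boundary, smoothly embedded in `X` by the inclusion, with image `X₂ ∩ X₃` and boundary the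
central surface. [cite: GayKirby2016, Def. 1 and §4, Lemma 14] -/
theorem exists_H₂₃ {gen : ℕ}
    (hH : letI := (T.bsliceAtlas hc2 hη hL).chartedSpace
      ConnectedSpace T.H₂₃ ∧ HasHandleDecomposition 2 T.H₂₃ (handleCount 1 gen)) :
    T.ClauseIII gen 1 2 := by
  letI := (T.bsliceAtlas hc2 hη hL).chartedSpace
  haveI := T.compactSpace_H₂₃
  refine ⟨T.H₂₃, inferInstance, inferInstance, Subtype.val, (T.bsliceAtlas hc2 hη hL).isManifold,
    inferInstance, hH.1, hH.2, (T.bsliceAtlas hc2 hη hL).isSmoothEmbedding_subtype_val, ?_, ?_⟩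
  · rw [Subtype.range_val]; rfl
  · rw [T.image_boundary_H₂₃ hc2 hη hL, T.iInter_sectors hc2]

/-- **The sectors form a Gay–Kirby trisection, modulo the Morse-theoretic inputs** — the
version of `isGKTrisection_of` with the hypothesis on `H₂₃` reduced to the connectedness and
the handle decomposition of the structure `bsliceAtlas`. [cite: GayKirby2016, Def. 1; §4, Lemma 14; Thm. 4] -/
theorem isGKTrisection_of' {gen k₁ k₂ k₃ : ℕ}
    (h₁ : letI := T.D.cornerSliceAtlas.chartedSpace
      ConnectedSpace T.D.sector ∧ HasHandleDecomposition 3 T.D.sector (handleCount 1 k₁))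
    (h₂ : letI := (T.cornerSliceAtlas₂ hc2 hη hL).chartedSpace
      ConnectedSpace T.X₂ ∧ HasHandleDecomposition 3 T.X₂ (handleCount 1 k₂))
    (h₃ : letI := (T.cornerSliceAtlas₃ hc2 hη hL).chartedSpace
      ConnectedSpace T.X₃ ∧ HasHandleDecomposition 3 T.X₃ (handleCount 1 k₃))
    (hgM : IsMorse (𝓡 3) B.g)
    (hcount₁₂ : ∀ i, (criticalSetOfIndex (𝓡 3) B.g i ∩ B.g ⁻¹' Iic B.b).ncard = handleCount 1 gen i)
    (h0 : (criticalSetOfIndex (𝓡 3) B.g 0).Subsingleton)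
    (hcount₃₁ : ∀ i, (criticalSetOfIndex (𝓡 3) (fun y => B.b - B.g y) i ∩
      (fun y => B.b - B.g y) ⁻¹' Iic 0).ncard = handleCount 1 gen i)
    (htop : (criticalSetOfIndex (𝓡 3) B.g 3).Subsingleton)
    (hH₂₃ : letI := (T.bsliceAtlas hc2 hη hL).chartedSpace
      ConnectedSpace T.H₂₃ ∧ HasHandleDecomposition 2 T.H₂₃ (handleCount 1 gen)) :
    IsGKTrisection X gen ![k₁, k₂, k₃] T.sectors :=
  T.isGKTrisection_of hc2 hη hL h₁ h₂ h₃ hgM hcount₁₂ h0 hcount₃₁ htop (T.exists_H₂₃ hc2 hη hL hH₂₃)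

end Atlas

end TriData

end BiCollar

end Literature.Topology.FourManifolds

end
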